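import Summits.RiemannHypothesis.RiemannHypothesis.Theorems.WeilFormatCCinfExactTables
import HarnessLib

/-!
# Format C, design C∞ (E2 data side): stage E — entrywise linear combinations of claimed tables with exact scalars

Route context: Fourier–Galerkin / Schur-complement certificates of Weil positivity on a window ("format C", C∞ door;
pipeline spec `run/shared/lean/pub/rh-explicit/rh-explicit-weil-2/gen16/E2F-CERT-PIPELINE.md` §2 (S2); supporting
stmt-RiemannHypothesis-0098; seat rh-explicit-weil-2).

The last arithmetic step before the door's u-grid check assembles the certificate matrix ENTRYWISE from claimed `n × n`
tables: `S = C − T − c₁·Ha − c₁·Hb − diag(c₂·R)` (constant part, middle Gram, the two Hankel sums, the remainder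
diagonal), with EXACT dyadic scalars (`1`, `(1+θ)/d₁`, `(1+1/θ)·We/d₁`).  Generic:

* real object `CinfStageE2.EgenR c X K d Y K' p t = Σ_{s<K} c s · X s p t + (if p = t then Σ_{s<K'} d s · Y s p else 0)`;
* input: `∀ s < K, TabNear (X s) n n (cx s) (ρ s) (XZ s)`, `∀ s < K', VecNear (Y s) n (cy s) (ρ' s) (YZ s)`, exact scalars
  `c s = CZ s / 2^cc`, `d s = DZ s / 2^cc`, and shifts `e s`, `e' s` bringing every product to ONE exact scale `E`
  (`cc + cx s + e s = E`, `cc + cy s + e' s = E`);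
* kernel work: `rowE … p` = the exact integer row `(Σ_s CZ s · XZ_s[p][t] · 2^(e s) + [p = t] Σ_s DZ s · YZ_s[p] · 2^(e' s))_t`,
  compared with the claim `OZ` at scale `cO = E − k` in row bands (`checkErows`, `ERows.zero/extend`), plus the budget
  `Σ_s |CZ s|·ρ s·2^(e s) + Σ_s |DZ s|·ρ' s·2^(e' s) + 2^k ≤ ρO·2^k`;
* output: `TabNear (EgenR …) n n cO ρO OZ` (`stageE_tabNear`).

Standard axioms; no RH claim.
-/

set_option autoImplicit false
-- `Summit.RiemannHypothesis.RiemannHypothesis.…` is the layout-mandated namespace (summit = problem name).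
set_option linter.dupNamespace false

open Finset

namespace Summit.RiemannHypothesis.RiemannHypothesis.Theorems.WeilFormatC

open Literature.NumberTheory.LFunctions (PsdDyadic.getMZ)

namespace CinfStageE2

/-! ## The real object -/

/-- `Σ_{s<K} c s · X s p t + [p = t] Σ_{s<K'} d s · Y s p`. -/
noncomputable def EgenR (c : ℕ → ℝ) (X : ℕ → ℕ → ℕ → ℝ) (K : ℕ) (d : ℕ → ℝ) (Y : ℕ → ℕ → ℝ) (K' : ℕ)
    (p t : ℕ) : ℝ :=
  ∑ s ∈ range K, c s * X s p t + if p = t then ∑ s ∈ range K', d s * Y s p else 0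

/-! ## The integer computation and the checks -/

/-- `Σ_{s<K} CZ s · XZ_s[p][t] · 2^(e s)` (structural in `K`). -/
def sumTerms (CZ : ℕ → ℤ) (XZ : ℕ → List (List ℤ)) (e : ℕ → ℕ) (p t : ℕ) : ℕ → ℤ
  | 0 => 0
  | s + 1 => sumTerms CZ XZ e p t s + CZ s * PsdDyadic.getMZ (XZ s) p t * 2 ^ e s

/-- `Σ_{s<K'} DZ s · YZ_s[p] · 2^(e' s)` (structural in `K'`). -/
def sumDiag (DZ : ℕ → ℤ) (YZ : ℕ → List ℤ) (e' : ℕ → ℕ) (p : ℕ) : ℕ → ℤ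
  | 0 => 0
  | s + 1 => sumDiag DZ YZ e' p s + DZ s * (YZ s).getD p 0 * 2 ^ e' s

/-- Entry `(p,t)` of the exact integer output (scale `2^E`). -/
def entryE (CZ : ℕ → ℤ) (XZ : ℕ → List (List ℤ)) (e : ℕ → ℕ) (K : ℕ) (DZ : ℕ → ℤ) (YZ : ℕ → List ℤ)
    (e' : ℕ → ℕ) (K' : ℕ) (p t : ℕ) : ℤ :=
  sumTerms CZ XZ e p t K + if p = t then sumDiag DZ YZ e' p K' else 0

/-- Row `p` of the exact integer output. -/
def rowE (CZ : ℕ → ℤ) (XZ : ℕ → List (List ℤ)) (e : ℕ → ℕ) (K : ℕ) (DZ : ℕ → ℤ) (YZ : ℕ → List ℤ)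
    (e' : ℕ → ℕ) (K' : ℕ) (n p : ℕ) : List ℤ :=
  (List.range n).map fun t ↦ entryE CZ XZ e K DZ YZ e' K' p t

/-- `|x − y·2^k| ≤ 2^k` entrywise for two integer lists of equal length. -/
def nearShiftL (k : ℕ) : List ℤ → List ℤ → Bool
  | [], [] => true
  | x :: xs, y :: ys => decide (|x - y * 2 ^ k| ≤ 2 ^ k) && nearShiftL k xs ys
  | _, _ => false

/-- Specification of `nearShiftL`. -/
theorem nearShiftL_spec {k : ℕ} : ∀ {xs ys : List ℤ}, nearShiftL k xs ys = true →
    ys.length = xs.length ∧ ∀ t < xs.length, |xs.getD t 0 - ys.getD t 0 * 2 ^ k| ≤ 2 ^ k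
  | [], [], _ => by simp
  | [], _ :: _, h => by simp [nearShiftL] at h
  | _ :: _, [], h => by simp [nearShiftL] at h
  | x :: xs, y :: ys, h => by
      simp only [nearShiftL, Bool.and_eq_true, decide_eq_true_eq] at h
      obtain ⟨hl, hi⟩ := nearShiftL_spec h.2
      refine ⟨by simp [hl], fun t ht ↦ ?_⟩
      cases t with
      | zero => simpa using h.1
      | succ t => simp only [List.getD_cons_succ]; exact hi t (by simpa using ht)

/-- **Band check**: rows `[p₀, p₀+kb)` of the claim `OZ` are the computed rows up to the shift `k`. -/
def checkErows (CZ : ℕ → ℤ) (XZ : ℕ → List (List ℤ)) (e : ℕ → ℕ) (K : ℕ) (DZ : ℕ → ℤ) (YZ : ℕ → List ℤ)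
    (e' : ℕ → ℕ) (K' n k : ℕ) (OZ : List (List ℤ)) (p₀ kb : ℕ) : Bool :=
  CinfExact.allFromTo p₀ kb fun p ↦ nearShiftL k (rowE CZ XZ e K DZ YZ e' K' n p) (OZ.getD p [])

/-- `ERows … m`: rows below `m` of `OZ` are the computed rows up to the shift. -/
structure ERows (CZ : ℕ → ℤ) (XZ : ℕ → List (List ℤ)) (e : ℕ → ℕ) (K : ℕ) (DZ : ℕ → ℤ) (YZ : ℕ → List ℤ)
    (e' : ℕ → ℕ) (K' n k : ℕ) (OZ : List (List ℤ)) (m : ℕ) : Prop where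
  /-- rounding enclosure of every entry of every row below `m` -/
  out : ∀ p < m, ∀ t < n, |entryE CZ XZ e K DZ YZ e' K' p t - PsdDyadic.getMZ OZ p t * 2 ^ k| ≤ 2 ^ k

/-- Band glue: no rows yet. -/
theorem ERows.zero {CZ : ℕ → ℤ} {XZ : ℕ → List (List ℤ)} {e : ℕ → ℕ} {K : ℕ} {DZ : ℕ → ℤ} {YZ : ℕ → List ℤ}
    {e' : ℕ → ℕ} {K' n k : ℕ} {OZ : List (List ℤ)} : ERows CZ XZ e K DZ YZ e' K' n k OZ 0 :=
  ⟨fun _ hp ↦ absurd hp (by omega)⟩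

/-- **Band glue**: one passing band extends the rows. -/
theorem ERows.extend {CZ : ℕ → ℤ} {XZ : ℕ → List (List ℤ)} {e : ℕ → ℕ} {K : ℕ} {DZ : ℕ → ℤ} {YZ : ℕ → List ℤ}
    {e' : ℕ → ℕ} {K' n k : ℕ} {OZ : List (List ℤ)} {m kb : ℕ} (h1 : ERows CZ XZ e K DZ YZ e' K' n k OZ m)
    (h2 : checkErows CZ XZ e K DZ YZ e' K' n k OZ m kb = true) : ERows CZ XZ e K DZ YZ e' K' n k OZ (m + kb) := by
  refine ⟨fun p hp t ht ↦ ?_⟩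
  by_cases hpm : p < m
  · exact h1.out p hpm t ht
  · have hb := CinfExact.allFromTo_spec h2 p (by omega) hp
    obtain ⟨-, hnear⟩ := nearShiftL_spec hb
    have hlen : (rowE CZ XZ e K DZ YZ e' K' n p).length = n := by simp [rowE]
    have h3 := hnear t (by rw [hlen]; exact ht)
    have e4 : (rowE CZ XZ e K DZ YZ e' K' n p).getD t 0 = entryE CZ XZ e K DZ YZ e' K' p t := by
      rw [rowE, List.getD_eq_getElem?_getD, List.getElem?_map, List.getElem?_range ht]; rfl
    rw [e4] at h3
    simpa [PsdDyadic.getMZ] using h3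

/-- `Σ_{s<K} |CZ s|·ρ s·2^(e s)` (structural). -/
def budgetX (CZ : ℕ → ℤ) (ρ e : ℕ → ℕ) : ℕ → ℕ
  | 0 => 0
  | s + 1 => budgetX CZ ρ e s + (CZ s).natAbs * ρ s * 2 ^ e s

/-- **Budget**: `Σ_s |CZ s| ρ s 2^(e s) + Σ_s |DZ s| ρ' s 2^(e' s) + 2^k ≤ ρO·2^k`, and the scale bookkeeping
`cc + cx s + e s = E`, `cc + cy s + e' s = E`. -/
def checkEBudget (CZ : ℕ → ℤ) (ρ e cx : ℕ → ℕ) (K : ℕ) (DZ : ℕ → ℤ) (ρ' e' cy : ℕ → ℕ) (K' : ℕ)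
    (cc E k ρO : ℕ) : Bool :=
  decide (budgetX CZ ρ e K + budgetX DZ ρ' e' K' + 2 ^ k ≤ ρO * 2 ^ k)
    && (CinfExact.allFromTo 0 K fun s ↦ decide (cc + cx s + e s = E))
    && (CinfExact.allFromTo 0 K' fun s ↦ decide (cc + cy s + e' s = E))

/-! ## Soundness -/

/-- (helper) `budgetX_eq`. -/
private theorem budgetX_eq (CZ : ℕ → ℤ) (ρ e : ℕ → ℕ) :
    ∀ K : ℕ, (budgetX CZ ρ e K : ℝ) = ∑ s ∈ range K, |(CZ s : ℝ)| * ρ s * 2 ^ e s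
  | 0 => by simp [budgetX]
  | K + 1 => by
      rw [budgetX, Finset.sum_range_succ]; push_cast
      rw [budgetX_eq CZ ρ e K, Nat.cast_natAbs, Int.cast_abs]

/-- (helper) `sumTerms_eq`. -/
private theorem sumTerms_eq (CZ : ℕ → ℤ) (XZ : ℕ → List (List ℤ)) (e : ℕ → ℕ) (p t : ℕ) :
    ∀ K : ℕ, (sumTerms CZ XZ e p t K : ℝ)
      = ∑ s ∈ range K, (CZ s : ℝ) * (PsdDyadic.getMZ (XZ s) p t : ℝ) * 2 ^ e s
  | 0 => by simp [sumTerms]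
  | K + 1 => by rw [sumTerms, Finset.sum_range_succ]; push_cast; rw [sumTerms_eq CZ XZ e p t K]

/-- (helper) `sumDiag_eq`. -/
private theorem sumDiag_eq (DZ : ℕ → ℤ) (YZ : ℕ → List ℤ) (e' : ℕ → ℕ) (p : ℕ) :
    ∀ K' : ℕ, (sumDiag DZ YZ e' p K' : ℝ) = ∑ s ∈ range K', (DZ s : ℝ) * ((YZ s).getD p 0 : ℝ) * 2 ^ e' s
  | 0 => by simp [sumDiag]
  | K + 1 => by rw [sumDiag, Finset.sum_range_succ]; push_cast; rw [sumDiag_eq DZ YZ e' p K]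

/-- **Stage E soundness.** -/
theorem stageE_tabNear {c d : ℕ → ℝ} {X : ℕ → ℕ → ℕ → ℝ} {Y : ℕ → ℕ → ℝ} {K K' n cc E k cO ρO : ℕ}
    {cx cy ρ ρ' e e' : ℕ → ℕ} {CZ DZ : ℕ → ℤ} {XZ : ℕ → List (List ℤ)} {YZ : ℕ → List ℤ} {OZ : List (List ℤ)}
    (hc : ∀ s < K, c s = (CZ s : ℝ) / 2 ^ cc) (hd : ∀ s < K', d s = (DZ s : ℝ) / 2 ^ cc)
    (hX : ∀ s < K, CinfExact.TabNear (X s) n n (cx s) (ρ s) (XZ s))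
    (hY : ∀ s < K', CinfExact.VecNear (Y s) n (cy s) (ρ' s) (YZ s))
    (hbudget : checkEBudget CZ ρ e cx K DZ ρ' e' cy K' cc E k ρO = true) (hcO : cO + k = E)
    (hrows : ERows CZ XZ e K DZ YZ e' K' n k OZ n) :
    CinfExact.TabNear (EgenR c X K d Y K') n n cO ρO OZ := by
  simp only [checkEBudget, Bool.and_eq_true, decide_eq_true_eq] at hbudget
  obtain ⟨⟨hbud, hsc⟩, hsc'⟩ := hbudget
  have hscale : ∀ s < K, cc + cx s + e s = E := fun s hs ↦ by
    have := CinfExact.allFromTo_spec hsc s (Nat.zero_le _) (by simpa using hs)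
    rwa [decide_eq_true_eq] at this
  have hscale' : ∀ s < K', cc + cy s + e' s = E := fun s hs ↦ by
    have := CinfExact.allFromTo_spec hsc' s (Nat.zero_le _) (by simpa using hs)
    rwa [decide_eq_true_eq] at this
  have hbud' : (budgetX CZ ρ e K : ℝ) + budgetX DZ ρ' e' K' + 2 ^ k ≤ ρO * 2 ^ k := by exact_mod_cast hbud
  rw [budgetX_eq, budgetX_eq] at hbud'
  have h2E : (0 : ℝ) < 2 ^ E := by positivity
  have h2O : (0 : ℝ) < 2 ^ cO := by positivity
  have hpow : (2 : ℝ) ^ cO * 2 ^ k = 2 ^ E := by rw [← pow_add, hcO]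
  -- scale identities: a product `(CZ/2^cc)·(x̄/2^cx)` at scale `E`
  have hsplit : ∀ s < K, (2 : ℝ) ^ E = 2 ^ cc * 2 ^ cx s * 2 ^ e s := fun s hs ↦ by
    rw [← pow_add, ← pow_add, hscale s hs]
  have hsplit' : ∀ s < K', (2 : ℝ) ^ E = 2 ^ cc * 2 ^ cy s * 2 ^ e' s := fun s hs ↦ by
    rw [← pow_add, ← pow_add, hscale' s hs]
  refine ⟨fun p hp t ht ↦ ?_⟩
  -- (1) off-diagonal family
  have hterm : ∀ s < K, |c s * X s p t - (CZ s : ℝ) * (PsdDyadic.getMZ (XZ s) p t : ℝ) * 2 ^ e s / 2 ^ E|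
      ≤ |(CZ s : ℝ)| * ρ s * 2 ^ e s / 2 ^ E := by
    intro s hs
    have hx := (hX s hs).out p hp t ht
    have e1 : (CZ s : ℝ) * (PsdDyadic.getMZ (XZ s) p t : ℝ) * 2 ^ e s / 2 ^ E
        = c s * ((PsdDyadic.getMZ (XZ s) p t : ℝ) / 2 ^ cx s) := by
      rw [hc s hs, hsplit s hs]; field_simp
    have e2 : |(CZ s : ℝ)| * ρ s * 2 ^ e s / 2 ^ E = |c s| * ((ρ s : ℝ) / 2 ^ cx s) := by
      rw [hc s hs, hsplit s hs, abs_div, abs_of_pos (by positivity : (0 : ℝ) < 2 ^ cc)]; field_simp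
    rw [e1, e2, ← mul_sub, abs_mul]
    exact mul_le_mul_of_nonneg_left hx (abs_nonneg _)
  have hsumX : |∑ s ∈ range K, c s * X s p t - (sumTerms CZ XZ e p t K : ℝ) / 2 ^ E|
      ≤ (∑ s ∈ range K, |(CZ s : ℝ)| * ρ s * 2 ^ e s) / 2 ^ E := by
    rw [sumTerms_eq, Finset.sum_div, ← Finset.sum_sub_distrib, Finset.sum_div]
    exact (Finset.abs_sum_le_sum_abs _ _).trans (Finset.sum_le_sum fun s hs ↦ hterm s (Finset.mem_range.1 hs))
  -- (2) diagonal family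
  have hterm' : ∀ s < K', |d s * Y s p - (DZ s : ℝ) * ((YZ s).getD p 0 : ℝ) * 2 ^ e' s / 2 ^ E|
      ≤ |(DZ s : ℝ)| * ρ' s * 2 ^ e' s / 2 ^ E := by
    intro s hs
    have hy := (hY s hs).out p hp
    have e1 : (DZ s : ℝ) * ((YZ s).getD p 0 : ℝ) * 2 ^ e' s / 2 ^ E = d s * (((YZ s).getD p 0 : ℝ) / 2 ^ cy s) := by
      rw [hd s hs, hsplit' s hs]; field_simp
    have e2 : |(DZ s : ℝ)| * ρ' s * 2 ^ e' s / 2 ^ E = |d s| * ((ρ' s : ℝ) / 2 ^ cy s) := by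
      rw [hd s hs, hsplit' s hs, abs_div, abs_of_pos (by positivity : (0 : ℝ) < 2 ^ cc)]; field_simp
    rw [e1, e2, ← mul_sub, abs_mul]
    exact mul_le_mul_of_nonneg_left hy (abs_nonneg _)
  have hsumY : |(∑ s ∈ range K', d s * Y s p) - (sumDiag DZ YZ e' p K' : ℝ) / 2 ^ E|
      ≤ (∑ s ∈ range K', |(DZ s : ℝ)| * ρ' s * 2 ^ e' s) / 2 ^ E := by
    rw [sumDiag_eq, Finset.sum_div, ← Finset.sum_sub_distrib, Finset.sum_div]
    exact (Finset.abs_sum_le_sum_abs _ _).trans (Finset.sum_le_sum fun s hs ↦ hterm' s (Finset.mem_range.1 hs))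
  -- (3) the exact midpoint of the entry
  have hmid : |EgenR c X K d Y K' p t - (entryE CZ XZ e K DZ YZ e' K' p t : ℝ) / 2 ^ E|
      ≤ (∑ s ∈ range K, |(CZ s : ℝ)| * ρ s * 2 ^ e s) / 2 ^ E
        + (∑ s ∈ range K', |(DZ s : ℝ)| * ρ' s * 2 ^ e' s) / 2 ^ E := by
    rw [EgenR, entryE]
    by_cases hpt : p = t
    · rw [if_pos hpt, if_pos hpt]
      push_cast
      rw [add_div]
      calc |∑ s ∈ range K, c s * X s p t + ∑ s ∈ range K', d s * Y s p
              - ((sumTerms CZ XZ e p t K : ℝ) / 2 ^ E + (sumDiag DZ YZ e' p K' : ℝ) / 2 ^ E)|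
          = |(∑ s ∈ range K, c s * X s p t - (sumTerms CZ XZ e p t K : ℝ) / 2 ^ E)
              + (∑ s ∈ range K', d s * Y s p - (sumDiag DZ YZ e' p K' : ℝ) / 2 ^ E)| := by ring_nf
        _ ≤ _ := (abs_add_le _ _).trans (add_le_add hsumX hsumY)
    · rw [if_neg hpt, if_neg hpt, add_zero]
      push_cast
      rw [add_zero]
      refine hsumX.trans ?_
      have : 0 ≤ (∑ s ∈ range K', |(DZ s : ℝ)| * ρ' s * 2 ^ e' s) / 2 ^ E :=
        div_nonneg (Finset.sum_nonneg fun s _ ↦ by positivity) h2E.le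
      linarith
  -- (4) rounding
  have hround := hrows.out p hp t ht
  have hround' : |(entryE CZ XZ e K DZ YZ e' K' p t : ℝ) - (PsdDyadic.getMZ OZ p t : ℝ) * 2 ^ k| ≤ 2 ^ k := by
    exact_mod_cast hround
  have step2 : |(entryE CZ XZ e K DZ YZ e' K' p t : ℝ) / 2 ^ E - (PsdDyadic.getMZ OZ p t : ℝ) / 2 ^ cO|
      ≤ (2 : ℝ) ^ k / 2 ^ E := by
    have e : (entryE CZ XZ e K DZ YZ e' K' p t : ℝ) / 2 ^ E - (PsdDyadic.getMZ OZ p t : ℝ) / 2 ^ cO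
        = ((entryE CZ XZ e K DZ YZ e' K' p t : ℝ) - (PsdDyadic.getMZ OZ p t : ℝ) * 2 ^ k) / 2 ^ E := by
      rw [← hpow]; field_simp
    rw [e, abs_div, abs_of_pos h2E]
    exact div_le_div_of_nonneg_right hround' h2E.le
  have hfin : (∑ s ∈ range K, |(CZ s : ℝ)| * ρ s * 2 ^ e s) / 2 ^ E
      + (∑ s ∈ range K', |(DZ s : ℝ)| * ρ' s * 2 ^ e' s) / 2 ^ E + (2 : ℝ) ^ k / 2 ^ E ≤ (ρO : ℝ) / 2 ^ cO := by
    rw [← add_div, ← add_div, div_le_div_iff₀ h2E h2O]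
    calc (∑ s ∈ range K, |(CZ s : ℝ)| * ρ s * 2 ^ e s + ∑ s ∈ range K', |(DZ s : ℝ)| * ρ' s * 2 ^ e' s
            + (2 : ℝ) ^ k) * 2 ^ cO ≤ (ρO : ℝ) * 2 ^ k * 2 ^ cO := by gcongr
      _ = (ρO : ℝ) * 2 ^ E := by rw [← hpow]; ring
  calc |EgenR c X K d Y K' p t - (PsdDyadic.getMZ OZ p t : ℝ) / 2 ^ cO|
      ≤ |EgenR c X K d Y K' p t - (entryE CZ XZ e K DZ YZ e' K' p t : ℝ) / 2 ^ E|
        + |(entryE CZ XZ e K DZ YZ e' K' p t : ℝ) / 2 ^ E - (PsdDyadic.getMZ OZ p t : ℝ) / 2 ^ cO| :=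
        abs_sub_le _ _ _
    _ ≤ _ := add_le_add hmid step2
    _ ≤ (ρO : ℝ) / 2 ^ cO := hfin

end CinfStageE2

end Summit.RiemannHypothesis.RiemannHypothesis.Theorems.WeilFormatC
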